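import Mathlib.Analysis.InnerProductSpace.Adjoint
import Mathlib.Analysis.InnerProductSpace.Projection.Basic

/-!
# T5IntertwinerIsometry — the Hilbert-space fragments of [Bo72] 5.4–5.5 used in N4.3 (A3)

Kernel forms of the abstract Hilbert-space sentences inside the two printed arguments that
route/T5-N4-p5.md v12 (A3) STEPS 3 (β)/(δ) and 4 consume from A. Borel, «Représentations de
Groupes Localement Compacts», LNM 276, §5.4–5.5 (cell pub-hodge-repro2, seat p5).  Everything here
is about continuous linear maps between Hilbert spaces `E`, `F` over `𝕜` (`RCLike 𝕜`), adjoints,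
orthogonal projections and families of operators `ρ g`; NOTHING about groups, unitary
representations, irreducibility or the spectral theorem is asserted — in particular the Schur lemma
«π irreducible ⇒ R(π, π) = ℂ·I» (5.4, from the spectral theorem) stays the prose's cited input.

Dictionary (prose ↦ kernel):
* 5.5 «A ∈ R(π, π′) − {0} ⇒ A*A = c·I (c > 0) [Schur] … donc A est une application linéaire continue
  d'image fermée … à une homothétie près, un isomorphisme de V_π sur un sous-espace W fermé de
  V_{π′} stable par G» — the part AFTER Schur: `inner_apply_apply` (⟪A x, A y⟫ = c ⟪x, y⟫),
  `norm_apply` (‖A x‖ = √c ‖x‖), `injective`, **`exists_linearIsometry`** (A = √c · U with U a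
  linear isometry), **`isClosed_range`**, `range_map_le_of_comm` (the range is stable under every
  `ρ′ g` when `A` intertwines), `ker_map_le_of_comm`, **`exists_linearIsometryEquiv_range`** (the
  isomorphism of `E` onto the closed range intertwining `ρ` with `ρ′|_W`);
* 5.4 «(i) P stable par G ⇔ (iii) E_P ∈ R(π, π)», direction (iii) ⇒ (i): `map_le_of_starProjection_comm`
  (the direction (i) ⇒ (iii) for unitary `ρ` is row 11's `starProjection_comm_of_invariant`);
* 5.4 «π irréductible ⇔ R(π, π) se réduit aux homothéties», the ELEMENTARY direction ⇐:
  `eq_bot_or_eq_top_of_starProjection_eq_smul` (a closed subspace whose projection is a scalar is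
  `⊥` or `⊤`) and **`eq_bot_or_eq_top_of_forall_comm_exists_smul`** (commutant = scalars ⇒ every
  closed subspace whose projection commutes with the `ρ g` is `⊥` or `⊤`).
-/

noncomputable section

open ContinuousLinearMap
open scoped InnerProductSpace

namespace Summit.Ventures.HodgeRepro2.T5IntertwinerIsometry

variable {𝕜 E F : Type*} [RCLike 𝕜] [NormedAddCommGroup E] [InnerProductSpace 𝕜 E]
  [NormedAddCommGroup F] [InnerProductSpace 𝕜 F]

/-! ### [Bo72] 5.5 after Schur: `A* A = c·I` -/

section Adjoint

variable [CompleteSpace E] [CompleteSpace F]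

/-- If `A* A = c • 1` then `⟪A x, A y⟫ = c ⟪x, y⟫`. -/
theorem inner_apply_apply (A : E →L[𝕜] F) (c : 𝕜)
    (h : ContinuousLinearMap.adjoint A ∘L A = c • (1 : E →L[𝕜] E)) (x y : E) :
    ⟪A x, A y⟫_𝕜 = c * ⟪x, y⟫_𝕜 := by
  have hy : ContinuousLinearMap.adjoint A (A y) = c • y := by
    have := congrArg (fun T : E →L[𝕜] E => T y) h
    simpa using this
  rw [← ContinuousLinearMap.adjoint_inner_right, hy, inner_smul_right]

/-- If `A* A = c • 1` with `c` real then `‖A x‖² = c ‖x‖²`. -/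
theorem norm_apply_sq (A : E →L[𝕜] F) (c : ℝ)
    (h : ContinuousLinearMap.adjoint A ∘L A = (c : 𝕜) • (1 : E →L[𝕜] E)) (x : E) :
    ‖A x‖ ^ 2 = c * ‖x‖ ^ 2 := by
  have h1 := inner_apply_apply A (c : 𝕜) h x x
  rw [inner_self_eq_norm_sq_to_K, inner_self_eq_norm_sq_to_K] at h1
  exact_mod_cast h1

/-- The constant `c` of `A* A = c • 1` is non-negative as soon as `E ≠ 0`. -/
theorem nonneg_of_nontrivial [Nontrivial E] (A : E →L[𝕜] F) (c : ℝ)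
    (h : ContinuousLinearMap.adjoint A ∘L A = (c : 𝕜) • (1 : E →L[𝕜] E)) : 0 ≤ c := by
  obtain ⟨x, hx⟩ := exists_ne (0 : E)
  have h1 := norm_apply_sq A c h x
  have hx' : 0 < ‖x‖ ^ 2 := by positivity
  have h2 : 0 ≤ c * ‖x‖ ^ 2 := h1 ▸ sq_nonneg _
  exact nonneg_of_mul_nonneg_left h2 hx'

/-- If `A* A = c • 1` with `c ≥ 0` then `‖A x‖ = √c ‖x‖`. -/
theorem norm_apply (A : E →L[𝕜] F) (c : ℝ) (hc : 0 ≤ c)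
    (h : ContinuousLinearMap.adjoint A ∘L A = (c : 𝕜) • (1 : E →L[𝕜] E)) (x : E) :
    ‖A x‖ = Real.sqrt c * ‖x‖ := by
  have h1 := norm_apply_sq A c h x
  have h2 : ‖A x‖ = Real.sqrt (c * ‖x‖ ^ 2) := by
    rw [← h1, Real.sqrt_sq (norm_nonneg _)]
  rw [h2, Real.sqrt_mul hc, Real.sqrt_sq (norm_nonneg _)]

/-- 5.5: «ker A est … réduit à {0}» — for `c > 0`, `A` is injective. -/
theorem injective (A : E →L[𝕜] F) (c : ℝ) (hc : 0 < c)
    (h : ContinuousLinearMap.adjoint A ∘L A = (c : 𝕜) • (1 : E →L[𝕜] E)) :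
    Function.Injective A := by
  intro x y hxy
  have h1 := norm_apply A c hc.le h (x - y)
  rw [map_sub, hxy, sub_self, norm_zero] at h1
  have hs : Real.sqrt c ≠ 0 := (Real.sqrt_pos.mpr hc).ne'
  rcases mul_eq_zero.mp h1.symm with h2 | h2
  · exact absurd h2 hs
  · exact sub_eq_zero.mp (norm_eq_zero.mp h2)

/-- 5.5: «à une homothétie près, un isomorphisme … sur un sous-espace fermé» — for `c > 0`,
`A = √c · U` with `U : E →ₗᵢ[𝕜] F` a linear isometry. -/
theorem exists_linearIsometry (A : E →L[𝕜] F) (c : ℝ) (hc : 0 < c)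
    (h : ContinuousLinearMap.adjoint A ∘L A = (c : 𝕜) • (1 : E →L[𝕜] E)) :
    ∃ U : E →ₗᵢ[𝕜] F, ∀ x, A x = ((Real.sqrt c : ℝ) : 𝕜) • U x := by
  have hs : 0 < Real.sqrt c := Real.sqrt_pos.mpr hc
  have hs' : ((Real.sqrt c : ℝ) : 𝕜) ≠ 0 := by
    exact_mod_cast hs.ne'
  refine ⟨{ toLinearMap := (((Real.sqrt c)⁻¹ : ℝ) : 𝕜) • (A : E →ₗ[𝕜] F), norm_map' := ?_ }, ?_⟩
  · intro x
    simp only [LinearMap.smul_apply, ContinuousLinearMap.coe_coe, norm_smul, RCLike.norm_ofReal,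
      abs_of_pos (inv_pos.mpr hs), norm_apply A c hc.le h x]
    field_simp
  · intro x
    simp only [LinearIsometry.coe_mk, LinearMap.smul_apply, ContinuousLinearMap.coe_coe,
      smul_smul]
    rw [RCLike.ofReal_inv, mul_inv_cancel₀ hs', one_smul]

/-- 5.5: «une application linéaire continue d'image fermée» — for `c > 0`, the range of `A` is
closed. -/
theorem isClosed_range (A : E →L[𝕜] F) (c : ℝ) (hc : 0 < c)
    (h : ContinuousLinearMap.adjoint A ∘L A = (c : 𝕜) • (1 : E →L[𝕜] E)) :
    IsClosed (Set.range A) := by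
  obtain ⟨U, hU⟩ := exists_linearIsometry A c hc h
  have hs' : ((Real.sqrt c : ℝ) : 𝕜) ≠ 0 := by
    exact_mod_cast (Real.sqrt_pos.mpr hc).ne'
  have hrange : Set.range A = Set.range U := by
    ext y
    constructor
    · rintro ⟨x, rfl⟩
      exact ⟨((Real.sqrt c : ℝ) : 𝕜) • x, by rw [map_smul, hU]⟩
    · rintro ⟨x, rfl⟩
      refine ⟨(((Real.sqrt c : ℝ) : 𝕜)⁻¹) • x, ?_⟩
      rw [hU, map_smul, smul_smul, mul_inv_cancel₀ hs', one_smul]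
  rw [hrange]
  exact U.isometry.isClosedEmbedding.isClosed_range

end Adjoint

/-! ### Intertwiners: range and kernel are stable -/

section Intertwiner

variable {ι : Type*}

/-- If `A` intertwines the families `ρ` and `ρ'` (`A ∘ ρ g = ρ' g ∘ A`), the range of `A` is stable
under every `ρ' g` («un sous-espace W … stable par G»). -/
theorem range_map_le_of_comm (A : E →L[𝕜] F) (ρ : ι → E →L[𝕜] E) (ρ' : ι → F →L[𝕜] F)
    (hA : ∀ g, A ∘L ρ g = ρ' g ∘L A) (g : ι) :
    (LinearMap.range (A : E →ₗ[𝕜] F)).map (ρ' g : F →ₗ[𝕜] F) ≤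
      LinearMap.range (A : E →ₗ[𝕜] F) := by
  rintro _ ⟨_, ⟨x, rfl⟩, rfl⟩
  refine ⟨ρ g x, ?_⟩
  have := congrArg (fun T : E →L[𝕜] F => T x) (hA g)
  simpa using this

/-- If `A` intertwines `ρ` and `ρ'`, the kernel of `A` is stable under every `ρ g`
(«ker A est stable par G»). -/
theorem ker_map_le_of_comm (A : E →L[𝕜] F) (ρ : ι → E →L[𝕜] E) (ρ' : ι → F →L[𝕜] F)
    (hA : ∀ g, A ∘L ρ g = ρ' g ∘L A) (g : ι) :
    (LinearMap.ker (A : E →ₗ[𝕜] F)).map (ρ g : E →ₗ[𝕜] E) ≤ LinearMap.ker (A : E →ₗ[𝕜] F) := by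
  rintro _ ⟨x, hx, rfl⟩
  have hx' : A x = 0 := hx
  have := congrArg (fun T : E →L[𝕜] F => T x) (hA g)
  simp only [ContinuousLinearMap.comp_apply] at this
  simp [this, hx']

/-- 5.5, the conclusion: for `c > 0` and `A` intertwining `ρ` with `ρ'`, `E` is isometrically
isomorphic to the closed range `W` of `A` by a map `U` with `A = √c · U`, `W` is stable under every
`ρ' g`, and `U` intertwines `ρ` with the restriction of `ρ'` to `W`
(«établit une équivalence entre π et π′|_W»). -/
theorem exists_linearIsometryEquiv_range [CompleteSpace E] [CompleteSpace F]
    (A : E →L[𝕜] F) (c : ℝ) (hc : 0 < c)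
    (h : ContinuousLinearMap.adjoint A ∘L A = (c : 𝕜) • (1 : E →L[𝕜] E))
    (ρ : ι → E →L[𝕜] E) (ρ' : ι → F →L[𝕜] F) (hA : ∀ g, A ∘L ρ g = ρ' g ∘L A) :
    ∃ W : Submodule 𝕜 F, IsClosed (W : Set F) ∧ (∀ g, W.map (ρ' g : F →ₗ[𝕜] F) ≤ W) ∧
      ∃ U : E ≃ₗᵢ[𝕜] W, (∀ x, A x = ((Real.sqrt c : ℝ) : 𝕜) • (U x : F)) ∧
        ∀ g x, (U (ρ g x) : F) = ρ' g (U x : F) := by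
  obtain ⟨U₀, hU₀⟩ := exists_linearIsometry A c hc h
  have hs' : ((Real.sqrt c : ℝ) : 𝕜) ≠ 0 := by
    exact_mod_cast (Real.sqrt_pos.mpr hc).ne'
  have hrange : LinearMap.range U₀.toLinearMap = LinearMap.range (A : E →ₗ[𝕜] F) := by
    ext y
    constructor
    · rintro ⟨x, rfl⟩
      refine ⟨(((Real.sqrt c : ℝ) : 𝕜)⁻¹) • x, ?_⟩
      simp only [ContinuousLinearMap.coe_coe, LinearIsometry.coe_toLinearMap]
      rw [hU₀, map_smul, smul_smul, mul_inv_cancel₀ hs', one_smul]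
    · rintro ⟨x, rfl⟩
      exact ⟨((Real.sqrt c : ℝ) : 𝕜) • x, by simp [map_smul, hU₀]⟩
  refine ⟨LinearMap.range U₀.toLinearMap, ?_, ?_, U₀.equivRange, ?_, ?_⟩
  · have : ((LinearMap.range U₀.toLinearMap : Submodule 𝕜 F) : Set F) = Set.range U₀ := by
      ext y; simp
    rw [this]
    exact U₀.isometry.isClosedEmbedding.isClosed_range
  · intro g
    rw [hrange]
    exact range_map_le_of_comm A ρ ρ' hA g
  · intro x
    simp [hU₀]
  · intro g x
    have := congrArg (fun T : E →L[𝕜] F => T x) (hA g)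
    simp only [ContinuousLinearMap.comp_apply, hU₀, map_smul] at this
    simp only [LinearIsometry.equivRange_apply_coe]
    exact smul_right_injective F hs' this

end Intertwiner

/-! ### [Bo72] 5.4: projections in the commutant, and the elementary half of the Schur lemma -/

section Projection

variable {ι : Type*}

/-- 5.4 (iii) ⇒ (i): a closed subspace whose orthogonal projection commutes with `T` is stable
under `T`. -/
theorem map_le_of_starProjection_comm (W : Submodule 𝕜 E) [W.HasOrthogonalProjection]
    (T : E →L[𝕜] E) (hT : W.starProjection ∘L T = T ∘L W.starProjection) :
    W.map (T : E →ₗ[𝕜] E) ≤ W := by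
  rintro _ ⟨w, hw, rfl⟩
  have h1 := congrArg (fun S : E →L[𝕜] E => S w) hT
  simp only [ContinuousLinearMap.comp_apply, Submodule.starProjection_eq_self_iff.mpr hw] at h1
  show T w ∈ W
  exact Submodule.starProjection_eq_self_iff.mp h1

/-- A closed subspace whose orthogonal projection is a scalar multiple of the identity is `⊥`
or `⊤` (the scalar is an idempotent, hence `0` or `1`). -/
theorem eq_bot_or_eq_top_of_starProjection_eq_smul (W : Submodule 𝕜 E) [W.HasOrthogonalProjection]
    (c : 𝕜) (hc : W.starProjection = c • (1 : E →L[𝕜] E)) : W = ⊥ ∨ W = ⊤ := by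
  rcases subsingleton_or_nontrivial E with hE | hE
  · left
    rw [eq_bot_iff]
    intro w _
    rw [Submodule.mem_bot]
    exact Subsingleton.elim w 0
  have hidem : IsIdempotentElem c := by
    have h2 := W.isIdempotentElem_starProjection
    rw [IsIdempotentElem, hc] at h2
    obtain ⟨x, hx⟩ := exists_ne (0 : E)
    have h4 := congrArg (fun S : E →L[𝕜] E => S x) h2
    simp only [mul_apply_eq_comp, smul_apply, one_apply_eq_self, smul_smul] at h4
    exact smul_left_injective 𝕜 hx h4
  rcases IsIdempotentElem.iff_eq_zero_or_one.mp hidem with h0 | h1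
  · left
    rw [eq_bot_iff]
    intro w hw
    have := Submodule.starProjection_eq_self_iff.mpr hw
    rw [hc, h0] at this
    simpa using this.symm
  · right
    rw [eq_top_iff]
    intro v _
    rw [← Submodule.starProjection_eq_self_iff, hc, h1]
    simp

/-- 5.4, the elementary direction of «π irréductible ⇔ R(π, π) = homothéties»: if every operator
commuting with all the `ρ g` is a scalar, then every closed subspace whose orthogonal projection
commutes with all the `ρ g` is `⊥` or `⊤`. (For a unitary family `ρ`, the projection of every
`ρ`-stable closed subspace commutes with the `ρ g` — row 11's `starProjection_comm_of_invariant`.) -/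
theorem eq_bot_or_eq_top_of_forall_comm_exists_smul (ρ : ι → E →L[𝕜] E)
    (hschur : ∀ T : E →L[𝕜] E, (∀ g, T ∘L ρ g = ρ g ∘L T) → ∃ c : 𝕜, T = c • (1 : E →L[𝕜] E))
    (W : Submodule 𝕜 E) [W.HasOrthogonalProjection]
    (hW : ∀ g, W.starProjection ∘L ρ g = ρ g ∘L W.starProjection) : W = ⊥ ∨ W = ⊤ := by
  obtain ⟨c, hc⟩ := hschur W.starProjection hW
  exact eq_bot_or_eq_top_of_starProjection_eq_smul W c hc

end Projection

end Summit.Ventures.HodgeRepro2.T5IntertwinerIsometry
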